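import Summits.QuantumFields.YangMills.Theorems.BalabanUVNodesN19CentreSync
import HarnessLib

/-!
# BalabanUVNodes ∕ N19 constants window — the EXTRACTED VACUUM-ENERGY CONSTANTS' half of the other-kinds centre clause,
# as the tree's H-U5b-1 shape `T4GoodClassBudget.RecentDeviation` INHABITED from the in-edges N22 · N18 · N17 by name;
# the N19 knit v3 (cell `pub-ymgap`, D-0062 Track A, cluster K5, seat dag-n19-a gen 2; count-neutral)

HONEST FRAMING.  One fixed finite four-torus, rung (B)+1 — NOT infinite volume, NOT a mass gap, NOT the Clay problem.  NE7
(node U5; NE7-proper leaf `Spine.NE7.Core`) is NOT PRINTED in [Balaban1987RG1]–[Balaban1989LargeFieldII] and NOT PROVED here.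
Every analytic input is a HYPOTHESIS SHAPE of the tree consumed BY NAME; nothing of Bałaban's objects is instantiated; no
`def`, 0 `sorry`, standard axioms.  NOT a node discharge: a `--supports` helper for crux `SpineGivenEndpoint` (19182).

WHAT THIS ADDS TO `BalabanUVNodesN19CentreSync` (p411746).  There the knit v2 `core_summable_of_spineNodes_sync` replaced
hazard H-U5b-1 for the E-LEDGER by the in-edges and left the OTHER KINDS `oA, oB` with a centre clause (O′)
`|cO K t τ − c₀ K| ≤ vol·s_K`.  In the (2.25) format the E-factors are `1`-subtracted, so the other kinds CARRY the extracted
constants `exp(Σ_{X ∈ ledger(τ)} E(X; g, 1))` of each run ([Balaban1988Convergent] p. 262 «The constant E_k (depending on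
{Ω_j}, {Λ_j} also) is obtained by subtracting one-step vacuum energy expressions, generated in small field regions, from the
initial constant E.»).  Their two-run difference `Σ_{X ∈ ledger(τ)} (E^B(X;1_B) − E^A(X;1_A))` is NOT small (old domains), but
its `τ`-dependence is: against a `τ`-free REFERENCE LEDGER `All K ⊇ ledger(τ)` (all domains of scale `≤ K` not displaced by the
observable) it equals the `τ`-free bulk sum minus the sum over the domains the term EXCLUDES — and for a GOOD term those are
RECENT (the booking of the good class, interface condition I-3 of `t4/T4-EST-U5c.md`: older pending structures put the term in
the bad class; the tree's `T4GoodClassBudget.RecentOnly` on the log window `jlog(K) = K − ⌈Cl·log(K+1)⌉` of §3b there), each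
with a RATE-SMALL constant by `N19CentreSync.abs_const_sub_le_tower` (N22 `NE9 ∧ FadingMemory` · N18 `NE5` · node U2's output
from N17 `ScaleShiftRate` + `C.transport oneB = oneA`).  That is LITERALLY the tree's shape of H-U5b-1:
* §1 `recentDeviation_of_constRate` — `RecentDeviation (All K ∖ ledger) scale e^{−κd} c Cb θ′ 0 Cw vol Λ (jlog K) K` from the
  constants' rate, the booking `RecentOnly`, and window multiplicity inherited from the FULL-TORUS (0.26) multiplicity of
  `All K` (`multiplicity_mono`; one run, `τ`-free, printed-grade — it also DERIVES the knit's ledger multiplicity `hM`); hence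
  `|Σ_{All K ∖ ledger} c_X| ≤ vol·(Cb·Cw·windowSum θ′ Λ (jlog K) K)` (`T4GoodClassBudget.abs_sum_dev_le_windowSum`), summable in
  `K` for EVERY `θ′ < 1` (`summable_windowSum_log`).
* §2 THE KNIT v3 `core_summable_of_spineNodes_window` — a COROLLARY of v2 BY NAME: the other kinds written as
  `o = exp(Σ_{ledger} E(·;1))·o′`; the ledger multiplicity and scale binders DERIVED from `All K`; the booking `RecentOnly` of
  the excluded set; (O′) asked only of the REMAINING kinds `o′` (R-kind, boundary kind, run B's unmatched first step, N14's
  D-terms, the large-field operations' normalization constants p. 380, the two runs' main actions) ⇒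
  `∃ δ, Spine.NE7.Core l₀ vol T Bad P Q δ ∧ Summable δ` (N19 BY NAME ∧ node U4′'s summable leaf).
* §3 non-vacuity on the toy data of `N19CentreSync.spineNodes_sync_nonvacuous` (reference ledger = the term's ledger).

BINDER CENSUS OF THE EDGE AFTER THIS FILE.  By name from N16 · N17 · N18 · N22 (+ `hone`): the driven-background rate (v1), the
ledger's constants (v2), the EXCLUDED constants (v3).  Remaining, not a sibling node's statement: (F) the synchronised term
format `hfmtA hfmtB hint hoff hOfmtA hOfmtB` + the reference ledger and its BOOKING `hAll hrecent` (object-bound: the class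
expansion at the carriers of record and the definition of the bad class — dagwriter's `S_N27x`, the crux's
`stub_classExpansionAtRecord`, NODE O); (O″) = `hO′` + `hcO′` for the remaining kinds (sibling rows: `T4BoundaryRate`, NE-R1's
`uv_*` fields of `T4MatchingClosure.ReindexedBudget`, `Spine/NE1p`, NE3∕NE4 for the main actions); (S)(M)(T) printed-grade
(`hS hSle hMAll hU hG`); `hlo` the unprinted floor behind (0.31).

CITATION HEADER (LOCATIONS only, as transcribed in the imported modules; no decl carries a cite tag).  [Balaban1988Convergent]
T. Bałaban, CMP **119** (1988) 243–285 — (2.25)–(2.27) p. 259, p. 262, Thm 2 (2.43) p. 263.  [Balaban1987RG1] CMP **109** (1987)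
249–301 — (0.26) p. 257; (0.31), Thm 2 p. 259 (the conditional behind `EventualLowerH`, NEVER used as a result).
[Balaban1989LargeFieldII] CMP **122** (1989) 355–392 — p. 356, p. 380.  [King1986] CMP **102** (1986) 649–677, (3.10)–(3.13).
-/

open Finset MeasureTheory

namespace Summit.QuantumFields.YangMills.BalabanUVNodes.N19ConstantsWindow

open Literature.MathematicalPhysics.QuantumFieldTheory.Balaban1983to89
open T4OutputRate T4RecentScale T4GoodClassBudget T4CauchySum T4TowerRateComposition T4TowerRateDischarge
open T4EtaRateMin (Readings LocalRate NE3Shape)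
open T4RateLiaison (GaugeDominated)
open Summit.QuantumFields.BalabanUV.T4Continuum.Spine
open Summit.QuantumFields.YangMills.BalabanUVNodes.N19CentreSync

/-! ## §1 The tree's H-U5b-1 shape `RecentDeviation`, inhabited by rate-small constants on a recent excluded set -/

section Window

variable {κ : Type*} {dof All : Finset κ} {sc : κ → ℕ} {w c : κ → ℝ} {Cr θ Cw vol Λ : ℝ} {jstar K : ℕ}

/-- MULTIPLICITY IS INHERITED BY SUB-LEDGERS (nonnegative weights): the (0.26) count for a reference ledger `All` bounds every
`dof ⊆ All` — so ONE `τ`-free full-torus multiplicity serves every good term's ledger and every excluded set. [folklore] -/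
theorem multiplicity_mono (hsub : dof ⊆ All) (hw : ∀ i ∈ All, 0 ≤ w i) (hM : Multiplicity All sc w Cw vol Λ K) :
    Multiplicity dof sc w Cw vol Λ K := fun j hj =>
  (sum_le_sum_of_subset_of_nonneg (filter_subset_filter _ hsub)
    (fun i hi _ => hw i (mem_filter.mp hi).1)).trans (hM j hj)

/-- **`RecentDeviation` INHABITED**: per-element constants `|c_i| ≤ Cr θ^{sc i} w_i` with `w ≥ 0`, a RECENT-ONLY index set and
window multiplicity give the tree's shape of hazard H-U5b-1, `T4GoodClassBudget.RecentDeviation dof sc w c Cr θ 0 Cw vol Λ j⋆ K`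
(discrepancy `δ ≡ 0`: node U2's is already inside `Cr`). [folklore] -/
theorem recentDeviation_of_constRate (hw : ∀ i ∈ dof, 0 ≤ w i) (hc : ∀ i ∈ dof, |c i| ≤ Cr * θ ^ sc i * w i)
    (hrec : RecentOnly dof sc jstar K) (hM : WindowMultiplicity dof sc w Cw vol Λ jstar K) :
    RecentDeviation dof sc w c Cr θ (fun _ => 0) Cw vol Λ jstar K where
  nonneg := hw
  dev_le i hi := by simpa only [add_zero] using hc i hi
  recent := hrec
  mult := hM

/-- **THE EXCLUDED CONSTANTS' DEVIATION ≤ `vol ×` WINDOW SUM**: for `dof ⊆ All` recent-only with `All` of multiplicity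
`Cw·vol·Λ^{K−j}` and constants `|c_i| ≤ Cr θ^{sc i} w_i` (`w ≥ 0`, `Cr, θ ≥ 0`):
`|Σ_{dof} c_i| ≤ vol·(Cr·Cw·windowSum θ Λ j⋆ K)` (`abs_sum_dev_le_windowSum` on §1's instance). [folklore] -/
theorem abs_sum_const_le_windowSum (hsub : dof ⊆ All) (hw : ∀ i ∈ All, 0 ≤ w i)
    (hMAll : Multiplicity All sc w Cw vol Λ K) (hc : ∀ i ∈ dof, |c i| ≤ Cr * θ ^ sc i * w i) (hCr : 0 ≤ Cr)
    (hθ : 0 ≤ θ) (hrec : RecentOnly dof sc jstar K) :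
    |∑ i ∈ dof, c i| ≤ vol * (Cr * Cw * windowSum θ Λ jstar K) := by
  have hRD := recentDeviation_of_constRate (fun i hi => hw i (hsub hi)) hc hrec
    (windowMultiplicity_of_multiplicity (multiplicity_mono hsub hw hMAll))
  calc |∑ i ∈ dof, c i| ≤ Cr * (1 + 0) * (Cw * vol) * windowSum θ Λ jstar K :=
        abs_sum_dev_le_windowSum (δ := fun _ _ => 0) hRD (injectedRate_zero hθ le_rfl) hCr le_rfl hθ
    _ = vol * (Cr * Cw * windowSum θ Λ jstar K) := by ring

end Window

/-! ## §2 THE KNIT v3: other kinds = extracted constants × remaining kinds; reference ledger + booking; (O″) for the rest -/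

section SpineNodes

open FlowStep T4CouplingMatching

variable {C : Carriers} [DecidableEq C.Dom] {ι X : Type} [MeasurableSpace ι] {σ : Type*} [DecidableEq σ] {l₀ vol : ℝ}
  {T : ℕ → Finset σ} {Bad : ℕ → ℝ → Finset σ} {P Q : ℕ → ℝ → σ → ℝ} {μ : ℕ → ℝ → σ → Measure ι}
  {fac : ℕ → ℝ → σ → Finset C.Dom} {All : ℕ → Finset C.Dom} {R : Readings ι X} {W : Set (ℕ → ℝ)}
  {EA : Functional C C.BgA} {EB : Functional C C.BgB} {β : HBeta} {κ θ₅ C₅ C₉ ω θc γ b c Cβ C₃ θ₃ Pg θ' Cl : ℝ}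
  {q k₀ m : ℕ} {Λ Λβ : ℕ → ℕ → ℝ} {CU : (ℕ → ℝ) → ℕ → ℝ} {g : ℕ → ℕ → ℝ} {uA : ℕ → ι → C.BgA} {uB : ℕ → ι → C.BgB}
  {oneA : C.BgA} {oneB : C.BgB} {oA oB oA' oB' : ℕ → ℝ → σ → ι → ℝ} {S : ℕ → ℝ → σ → ℕ → ℝ} {cO' RO' : ℕ → ℝ → σ → ℝ}
  {rO' : ℕ → ℝ} {Cw E₀ a Λg : ℝ}

/-- **NODE N19 KNIT BY NAME FROM ITS IN-EDGES, v3 — THE EXTRACTED CONSTANTS PEELED OFF THE OTHER KINDS.**  Hypotheses: those of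
`N19CentreSync.core_summable_of_spineNodes_sync` (N16 · N17 + node U2's displayed inputs · N18 · N22; node U3's printed bracket;
window; common rate; format binders `hfmtA hfmtB hint hoff`; zero-centred size binder in the (2.43)-window profile; `hone`)
EXCEPT: the ledger's scale and multiplicity binders `hsc hM` are DERIVED from a `τ`-free REFERENCE LEDGER `All K ⊇ fac K t τ` of
domains of scale `≤ K` with the full-torus (0.26) multiplicity `hMAll`; the other kinds are written `o = exp(Σ_{fac} E(·; g, 1))·o′`
(`hOfmtA hOfmtB`, positivity `hposO′` of `o′`); the BOOKING: a good term excludes only RECENT domains,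
`RecentOnly (All K ∖ fac K t τ) scale (jlog_{Cl} K) K` (`hrecent`, `0 ≤ Cl`, `1 ≤ Λ`); and the centre clause is asked only of the
REMAINING kinds: `hO′ hRO′ hrO′ hcO′`.  CONCLUSION: `∃ δ, Spine.NE7.Core l₀ vol T Bad P Q δ ∧ Summable δ` — N19 BY NAME ∧ node
U4′'s summable leaf.  Proof: v2 with `cO K t τ := Σ_{fac}(E^B(·;1_B) − E^A(·;1_A)) + cO′ K t τ` and
`c₀ K := Σ_{All K}(…) + c₀′ K`; the difference is the excluded sum, `≤ vol·(Cb·Cw·windowSum θ′ Λ (jlog K) K)` by §1 with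
`Cb = b + C₅` of `abs_const_sub_le_tower`, summable by `summable_windowSum_log`.  CONDITIONAL on every binder; nothing of
Bałaban's is instantiated; NOT NE7. [folklore] -/
theorem core_summable_of_spineNodes_window (gIR : ℝ)
    -- the in-edges BY NAME
    (h16 : NE3Shape R C₃ θ₃) (hC₃ : 0 ≤ C₃) (hgd : GaugeDominated R uA uB)
    (h17 : ScaleShiftRate c θc γ β)
    (h18 : NE5 EA EB W κ θ₅ C₅) (hθ₅ : 0 ≤ θ₅) (hC₅ : 0 ≤ C₅)
    (h22 : NE9 EA W κ Λ ∧ T4OutputRate.FadingMemory C₉ ω Λ) (hω : 0 ≤ ω)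
    -- node U2's other displayed inputs (binders of `injectedRate_of_runs_eventual`)
    (hγ : 0 < γ) (hb : 0 < b) (hθc0 : 0 < θc) (hθc1 : θc < 1) (hc : 0 ≤ c) (hCβ : 0 ≤ Cβ)
    (hrun : ∀ K, RGEqH K β (g K)) (hbox : ∀ K i, i ≤ K → 0 < g K i ∧ g K i ≤ γ) (hpin : ∀ K, g K K = gIR)
    (hL : HistLipschitz Λβ γ β) (hΛβ : T4CouplingMatching.FadingMemory Cβ θc Λβ)
    (hlo : EventualLowerH b γ k₀ β) (hsmall : Cβ * (((k₀ : ℝ) + 1) * γ ^ 3 + 2 * γ / b) ≤ (1 - θc) / 2)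
    -- node U3's printed-ingredient bracket, the window, the common rate (`1 ≤ Λ` for the log window)
    (hU : LipBackground EA W κ CU) (hG : PolyLipGrowth CU g Pg q) (hPg : 0 ≤ Pg)
    (hgA : ∀ K, g K ∈ W) (hgB : ∀ K, (fun i => g (K + 1) (i + 1)) ∈ W)
    (hθ' : max ω θc < θ') (hθ₅' : θ₅ ≤ θ') (hθ₃' : θ₃ ≤ θ') (hθ'1 : θ' < 1) (hθ'Λ : θ' ≤ Λg) (hΛ1 : 1 ≤ Λg)
    -- the END's format binders on `R.dom`
    (hfmtA : ∀ K t τ, P K t τ = ∫ v, (∏ X ∈ fac K t τ,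
      Real.exp (EA (g K) (uA K v) X - EA (g K) oneA X)) * oA K t τ v ∂(μ K t τ))
    (hfmtB : ∀ K t τ, Q K t τ = ∫ v, (∏ X ∈ fac K t τ,
      Real.exp (EB (fun i => g (K + 1) (i + 1)) (uB K v) X - EB (fun i => g (K + 1) (i + 1)) oneB X)) *
        oB K t τ v ∂(μ K t τ))
    (hint : ∀ K t, |t| ≤ l₀ → ∀ τ ∈ T K \ Bad K t,
      Integrable (fun v => (∏ X ∈ fac K t τ, Real.exp (EA (g K) (uA K v) X - EA (g K) oneA X)) *
        oA K t τ v) (μ K t τ) ∧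
      Integrable (fun v => (∏ X ∈ fac K t τ,
        Real.exp (EB (fun i => g (K + 1) (i + 1)) (uB K v) X - EB (fun i => g (K + 1) (i + 1)) oneB X)) *
        oB K t τ v) (μ K t τ))
    (hoff : ∀ K t, |t| ≤ l₀ → ∀ τ ∈ T K \ Bad K t, ∀ v, v ∉ R.dom →
      (∏ X ∈ fac K t τ, Real.exp (EA (g K) (uA K v) X - EA (g K) oneA X)) * oA K t τ v = 0 ∧
      (∏ X ∈ fac K t τ,
        Real.exp (EB (fun i => g (K + 1) (i + 1)) (uB K v) X - EB (fun i => g (K + 1) (i + 1)) oneB X)) *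
        oB K t τ v = 0)
    -- NEW in v3: the τ-free REFERENCE LEDGER with (0.26) multiplicity, and the BOOKING of the good class (log window)
    (hAll : ∀ K t, |t| ≤ l₀ → ∀ τ ∈ T K \ Bad K t, fac K t τ ⊆ All K)
    (hAllsc : ∀ K, ∀ X ∈ All K, C.scale X ≤ K)
    (hMAll : ∀ K, Multiplicity (All K) C.scale (fun X => Real.exp (-(κ * C.d X))) Cw vol Λg K)
    (hCl : 0 ≤ Cl)
    (hrecent : ∀ K t, |t| ≤ l₀ → ∀ τ ∈ T K \ Bad K t, RecentOnly (All K \ fac K t τ) C.scale (jlogOf Cl K) K)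
    -- NEW in v3: the other kinds CARRY the extracted constants of the ledger; `o′` are the remaining kinds
    (hOfmtA : ∀ K t τ v, oA K t τ v = Real.exp (∑ X ∈ fac K t τ, EA (g K) oneA X) * oA' K t τ v)
    (hOfmtB : ∀ K t τ v, oB K t τ v =
      Real.exp (∑ X ∈ fac K t τ, EB (fun i => g (K + 1) (i + 1)) oneB X) * oB' K t τ v)
    (hposO' : ∀ K t, |t| ≤ l₀ → ∀ τ ∈ T K \ Bad K t, ∀ v ∈ R.dom, 0 < oA' K t τ v ∧ 0 < oB' K t τ v)
    -- the SIZE binder, ZERO-CENTRED as (2.43) is printed, in the (2.43)-window profile (`m = 0` = all-regular)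
    (hS : ∀ K t, |t| ≤ l₀ → ∀ τ ∈ T K \ Bad K t, ∀ v ∈ R.dom, ∀ j ≤ K,
      |∑ X ∈ fac K t τ with C.scale X = j,
          (Real.log (Real.exp (EB (fun i => g (K + 1) (i + 1)) (uB K v) X
              - EB (fun i => g (K + 1) (i + 1)) oneB X))
            - Real.log (Real.exp (EA (g K) (uA K v) X - EA (g K) oneA X)))| ≤ S K t τ j)
    (hvol : 0 ≤ vol) (hE₀ : 0 ≤ E₀) (ha0 : 0 < a) (ha1 : a < 1)
    (hSle : ∀ K t, |t| ≤ l₀ → ∀ τ ∈ T K \ Bad K t, ∀ j ≤ K,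
      S K t τ j ≤ vol * (E₀ * ((K : ℝ) + 1) ^ m * a ^ (K - j)))
    -- (O″): the REMAINING kinds match per good term with a centre within `vol·s′` of a class constant
    (hO' : ∀ K t, |t| ≤ l₀ → ∀ τ ∈ T K \ Bad K t, ∀ v ∈ R.dom,
      |Real.log (oB' K t τ v) - Real.log (oA' K t τ v) - cO' K t τ| ≤ RO' K t τ)
    (hRO' : ∀ K t, |t| ≤ l₀ → ∀ τ ∈ T K \ Bad K t, RO' K t τ ≤ vol * rO' K) (hrO' : Summable rO')
    (hone : C.transport oneB = oneA)
    (hcO' : ∃ c₀ s : ℕ → ℝ, Summable s ∧ ∀ K t, |t| ≤ l₀ → ∀ τ ∈ T K \ Bad K t, |cO' K t τ - c₀ K| ≤ vol * s K) :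
    ∃ δ : ℕ → ℝ, NE7.Core l₀ vol T Bad P Q δ ∧ Summable δ := by
  -- derived ledger binders: scales and multiplicity from the reference ledger, positivity of the full other kinds
  have hw : ∀ K, ∀ X ∈ All K, 0 ≤ Real.exp (-(κ * C.d X)) := fun _ _ _ => (Real.exp_pos _).le
  have hsc : ∀ K t, |t| ≤ l₀ → ∀ τ ∈ T K \ Bad K t, ∀ X ∈ fac K t τ, C.scale X ≤ K :=
    fun K t ht τ hτ X hX => hAllsc K X (hAll K t ht τ hτ hX)
  have hM : ∀ K t, |t| ≤ l₀ → ∀ τ ∈ T K \ Bad K t,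
      Multiplicity (fac K t τ) C.scale (fun X => Real.exp (-(κ * C.d X))) Cw vol Λg K :=
    fun K t ht τ hτ => multiplicity_mono (hAll K t ht τ hτ) (hw K) (hMAll K)
  have hposO : ∀ K t, |t| ≤ l₀ → ∀ τ ∈ T K \ Bad K t, ∀ v ∈ R.dom, 0 < oA K t τ v ∧ 0 < oB K t τ v :=
    fun K t ht τ hτ v hv => by
      obtain ⟨hA, hB⟩ := hposO' K t ht τ hτ v hv
      rw [hOfmtA, hOfmtB]
      exact ⟨mul_pos (Real.exp_pos _) hA, mul_pos (Real.exp_pos _) hB⟩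
  -- the constants' rate constant `Cb = b + C₅` and the window bound for the EXCLUDED constants (§1)
  have hθ'0 : 0 < θ' := lt_of_le_of_lt (hθc0.le.trans (le_max_right ω θc)) hθ'
  have hCb : 0 ≤ C₉ * (γ ^ 3 * (2 * c / (1 - θc))) * (θ' / (θ' - max ω θc)) + C₅ := by
    have h1 : 0 ≤ 2 * c / (1 - θc) := div_nonneg (mul_nonneg zero_le_two hc) (by linarith)
    have h2 : 0 ≤ θ' / (θ' - max ω θc) := div_nonneg hθ'0.le (sub_pos.mpr hθ').le
    exact add_nonneg (mul_nonneg (mul_nonneg (fadingMemory_const_nonneg h22.2)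
      (mul_nonneg (pow_nonneg hγ.le 3) h1)) h2) hC₅
  have hwin : ∀ K t, |t| ≤ l₀ → ∀ τ ∈ T K \ Bad K t,
      |∑ X ∈ All K \ fac K t τ, (EB (fun i => g (K + 1) (i + 1)) oneB X - EA (g K) oneA X)|
        ≤ vol * ((C₉ * (γ ^ 3 * (2 * c / (1 - θc))) * (θ' / (θ' - max ω θc)) + C₅) * Cw
            * windowSum θ' Λg (jlogOf Cl K) K) := fun K t ht τ hτ =>
    abs_sum_const_le_windowSum sdiff_subset (hw K) (hMAll K)
      (fun X hX => abs_const_sub_le_tower gIR h22 hω h18 hθ₅ hC₅ h17 hγ hb hθc0 hθc1 hc hCβ hrun hbox hpin hL hΛβ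
        hlo hsmall hgA hgB hθ' hθ₅' hone K X (hAllsc K X (sdiff_subset hX)))
      hCb hθ'0.le (hrecent K t ht τ hτ)
  obtain ⟨c₀', s', hs', hcO''⟩ := hcO'
  -- v2 BY NAME with the other-kinds centre `cO := Σ_{fac}(E^B(·;1_B) − E^A(·;1_A)) + cO′`
  refine core_summable_of_spineNodes_sync (oA := oA) (oB := oB)
    (cO := fun K t τ => (∑ X ∈ fac K t τ, (EB (fun i => g (K + 1) (i + 1)) oneB X - EA (g K) oneA X)) + cO' K t τ)
    (RO := RO') (rO := rO') gIR h16 hC₃ hgd h17 h18 hθ₅ hC₅ h22 hω hγ hb hθc0 hθc1 hc hCβ hrun hbox hpin hL hΛβ hlo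
    hsmall hU hG hPg hgA hgB hθ' hθ₅' hθ₃' hθ'1 hθ'Λ hfmtA hfmtB hint hsc hposO hoff hS hvol hE₀ ha0 ha1 hSle hM
    (fun K t ht τ hτ v hv => ?_) hRO' hrO' hone ⟨fun K => (∑ X ∈ All K,
      (EB (fun i => g (K + 1) (i + 1)) oneB X - EA (g K) oneA X)) + c₀' K, fun K =>
      (C₉ * (γ ^ 3 * (2 * c / (1 - θc))) * (θ' / (θ' - max ω θc)) + C₅) * Cw * windowSum θ' Λg (jlogOf Cl K) K + s' K,
      ((summable_windowSum_log hθ'0 hθ'1 hΛ1 hCl).mul_left _).add hs', fun K t ht τ hτ => ?_⟩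
  · -- `hO` for the full other kinds: the extracted constants are exactly the added centre
    obtain ⟨hA, hB⟩ := hposO' K t ht τ hτ v hv
    rw [hOfmtA, hOfmtB, Real.log_mul (Real.exp_pos _).ne' hB.ne', Real.log_mul (Real.exp_pos _).ne' hA.ne',
      Real.log_exp, Real.log_exp, sum_sub_distrib]
    have e : (∑ X ∈ fac K t τ, EB (fun i => g (K + 1) (i + 1)) oneB X) + Real.log (oB' K t τ v)
        - ((∑ X ∈ fac K t τ, EA (g K) oneA X) + Real.log (oA' K t τ v))
        - ((∑ X ∈ fac K t τ, EB (fun i => g (K + 1) (i + 1)) oneB X) - (∑ X ∈ fac K t τ, EA (g K) oneA X)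
          + cO' K t τ)
        = Real.log (oB' K t τ v) - Real.log (oA' K t τ v) - cO' K t τ := by ring
    rw [e]
    exact hO' K t ht τ hτ v hv
  · -- `hcO`: the centre minus the class constant is (minus) the EXCLUDED constants' sum plus the remaining deviation
    have hsplit := sum_sdiff (f := fun X => EB (fun i => g (K + 1) (i + 1)) oneB X - EA (g K) oneA X)
      (hAll K t ht τ hτ)
    have e : (∑ X ∈ fac K t τ, (EB (fun i => g (K + 1) (i + 1)) oneB X - EA (g K) oneA X)) + cO' K t τ
        - ((∑ X ∈ All K, (EB (fun i => g (K + 1) (i + 1)) oneB X - EA (g K) oneA X)) + c₀' K)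
        = -(∑ X ∈ All K \ fac K t τ, (EB (fun i => g (K + 1) (i + 1)) oneB X - EA (g K) oneA X))
          + (cO' K t τ - c₀' K) := by
      rw [← hsplit]; ring
    rw [e, mul_add]
    refine (abs_add_le _ _).trans (add_le_add ?_ (hcO'' K t ht τ hτ))
    rw [abs_neg]
    exact hwin K t ht τ hτ

end SpineNodes

/-! ## §3 Non-vacuity: the v3 binder set is met by the toy data of `N19CentreSync` (reference ledger = the term's ledger) -/

section Sanity

open FlowStep T4CouplingMatching
open Summit.QuantumFields.YangMills.BalabanUVNodes.N19CoreKnitSanity (toy_running toy_beta)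

/-- **NON-VACUITY OF THE KNIT v3.**  The toy data of `N19CentreSync.spineNodes_sync_nonvacuous` (any NE5 constant `C₅ ≥ 0`, rates `q`, common
rate `(1+q)∕2`, `Λ = 1`, running couplings of the constant β-function `b`, E-ledger `range (K+1)`, unit backgrounds `0`,
identity transport) with the reference ledger `All K = range (K+1)` (nothing excluded, so `RecentOnly` is vacuous and the
(0.26) multiplicity is one domain per scale), the other kinds `1 = exp(Σ E(·;0))·exp(−Σ E(·;0))`, and the remaining kinds'
centre read at the one field point meet ALL binders of `core_summable_of_spineNodes_window`, and the knit fires.  Consistency of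
the binder SET only; no physics. [folklore] -/
theorem spineNodes_window_nonvacuous {q b gIR C₅ : ℝ} (hq0 : 0 < q) (hq1 : q < 1) (hb : 0 < b) (hgIR : 0 < gIR)
    (hC₅ : 0 ≤ C₅) :
    ∃ δ : ℕ → ℝ, NE7.Core (ι := Unit) 1 1 (fun _ => Finset.univ) (fun _ _ => ∅)
        (fun K _ _ => ∫ _v, (∏ X ∈ range (K + 1),
          Real.exp (toyEA q q (fun k => (Real.sqrt ((gIR ^ 2)⁻¹ + b * ((K - k : ℕ) : ℝ)))⁻¹) (q ^ K) X
            - toyEA q q (fun k => (Real.sqrt ((gIR ^ 2)⁻¹ + b * ((K - k : ℕ) : ℝ)))⁻¹) 0 X)) * 1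
          ∂(Measure.dirac ()))
        (fun K _ _ => ∫ _v, (∏ X ∈ range (K + 1),
          Real.exp (toyEB q q C₅ (fun i => (Real.sqrt ((gIR ^ 2)⁻¹ + b * ((K + 1 - (i + 1) : ℕ) : ℝ)))⁻¹) (q ^ (K + 1)) X
            - toyEB q q C₅ (fun i => (Real.sqrt ((gIR ^ 2)⁻¹ + b * ((K + 1 - (i + 1) : ℕ) : ℝ)))⁻¹) 0 X)) * 1
          ∂(Measure.dirac ()))
        δ ∧ Summable δ := by
  obtain ⟨h9, hΛ, hU, h5⟩ := toy_nonvacuous (C₅ := C₅) hq0.le hq1.le hq0.le hC₅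
  obtain ⟨hloc, hgd, -, -, -⟩ := toy_nodes_hypotheses (θc := q) (γ := gIR) hq0.le hq1.le hgIR
  obtain ⟨hrun, hpin, hbox⟩ := toy_running hb.le hgIR
  obtain ⟨hS, hL, hΛβ, hlo, hsmall⟩ := toy_beta (b := b) (γ := gIR) hq1.le
  have h16 : NE3Shape
      ({ dom := Set.univ, act := fun _ _ => 0, loc := fun k _ _ => q ^ k, vol := 0, vol_nonneg := le_rfl } :
        Readings Unit Unit) 1 q :=
    { rate_nonneg := hq0.le, rate_lt_one := hq1, action := fun k V _ => by simp, pointwise := hloc }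
  have hθ' : max q q < (1 + q) / 2 := by rw [max_self]; linarith
  have hqθ' : q ≤ (1 + q) / 2 := by linarith
  have hθ'1 : (1 + q) / 2 < 1 := by linarith
  refine core_summable_of_spineNodes_window (C := toyCarriers) (σ := Unit) (W := Set.univ) (EA := toyEA q q)
    (EB := toyEB q q C₅) (β := fun _ _ => b) (Λ := fun k i => q ^ (k - i)) (Λβ := fun _ _ => 0)
    (CU := fun _ _ => (1 : ℝ)) (g := fun K k => (Real.sqrt ((gIR ^ 2)⁻¹ + b * ((K - k : ℕ) : ℝ)))⁻¹)
    (uA := fun K _ => (q ^ K : ℝ)) (uB := fun K _ => (q ^ (K + 1) : ℝ)) (oneA := (0 : ℝ)) (oneB := (0 : ℝ))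
    (oA := fun _ _ _ _ => 1) (oB := fun _ _ _ _ => 1)
    (oA' := fun K _ _ _ => Real.exp (-(∑ X ∈ range (K + 1),
      toyEA q q (fun k => (Real.sqrt ((gIR ^ 2)⁻¹ + b * ((K - k : ℕ) : ℝ)))⁻¹) 0 X)))
    (oB' := fun K _ _ _ => Real.exp (-(∑ X ∈ range (K + 1),
      toyEB q q C₅ (fun i => (Real.sqrt ((gIR ^ 2)⁻¹ + b * ((K + 1 - (i + 1) : ℕ) : ℝ)))⁻¹) 0 X)))
    (μ := fun _ _ _ => Measure.dirac ()) (fac := fun K _ _ => range (K + 1)) (All := fun K => range (K + 1))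
    (S := fun K _ _ j => (1 - q) * q ^ (K + j))
    (cO' := fun K _ _ =>
      Real.log (Real.exp (-(∑ X ∈ range (K + 1),
        toyEB q q C₅ (fun i => (Real.sqrt ((gIR ^ 2)⁻¹ + b * ((K + 1 - (i + 1) : ℕ) : ℝ)))⁻¹) 0 X)))
      - Real.log (Real.exp (-(∑ X ∈ range (K + 1),
        toyEA q q (fun k => (Real.sqrt ((gIR ^ 2)⁻¹ + b * ((K - k : ℕ) : ℝ)))⁻¹) 0 X))))
    (RO' := fun _ _ _ => 0) (rO' := fun _ => 0)
    (Cw := 1) (E₀ := 1) (a := q) (Λg := 1) (Cl := 0) (m := 0) (κ := 0) (Pg := 1) (q := 0) (k₀ := 0)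
    gIR h16 zero_le_one hgd hS h5 hq0.le hC₅ ⟨h9, hΛ⟩ hq0.le hgIR hb hq0 hq1 le_rfl le_rfl hrun hbox hpin hL
    hΛβ hlo hsmall hU (fun K j _ => ⟨zero_le_one, by simp⟩) zero_le_one (fun _ => Set.mem_univ _)
    (fun _ => Set.mem_univ _) hθ' hqθ' hqθ' hθ'1 hθ'1.le le_rfl
    (fun _ _ _ => rfl) (fun _ _ _ => rfl) (fun _ _ _ _ _ => ⟨Integrable.of_finite, Integrable.of_finite⟩)
    (fun _ _ _ _ _ v hv => absurd (Set.mem_univ v) hv)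
    (fun _ _ _ _ _ => Finset.Subset.refl _) (fun K X hX => Nat.le_of_lt_succ (mem_range.mp hX)) (fun K j hj => ?_)
    le_rfl (fun K _ _ _ _ X hX => absurd hX (by simp))
    (fun K _ _ _ => by rw [← Real.exp_add, add_neg_cancel, Real.exp_zero])
    (fun K _ _ _ => by rw [← Real.exp_add, add_neg_cancel, Real.exp_zero])
    (fun _ _ _ _ _ _ _ => ⟨Real.exp_pos _, Real.exp_pos _⟩) (fun K t _ τ _ v _ j hj => ?_)
    zero_le_one zero_le_one hq0 hq1 (fun K t _ τ _ j hj => ?_)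
    (fun _ _ _ _ _ _ _ => by simp) (fun _ _ _ _ _ => by simp) summable_zero rfl
    ⟨fun K => Real.log (Real.exp (-(∑ X ∈ range (K + 1),
        toyEB q q C₅ (fun i => (Real.sqrt ((gIR ^ 2)⁻¹ + b * ((K + 1 - (i + 1) : ℕ) : ℝ)))⁻¹) 0 X)))
      - Real.log (Real.exp (-(∑ X ∈ range (K + 1),
        toyEA q q (fun k => (Real.sqrt ((gIR ^ 2)⁻¹ + b * ((K - k : ℕ) : ℝ)))⁻¹) 0 X))),
      fun _ => 0, summable_zero, fun K t _ τ _ => by simp⟩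
  · -- `hMAll`: one domain per scale in the reference ledger, weight `e^0 = 1 ≤ 1·1·1^{K−j}`
    show ∑ i ∈ range (K + 1) with i = j, Real.exp (-(0 * (0 : ℝ))) ≤ 1 * 1 * (1 : ℝ) ^ (K - j)
    rw [Finset.filter_eq', if_pos (mem_range.mpr (Nat.lt_succ_of_le hj)), sum_singleton]
    simp
  · -- `hS`: the zero-centred toy slice (as in `N19CentreSync.spineNodes_sync_nonvacuous`)
    show |∑ X ∈ range (K + 1) with X = j,
        (Real.log (Real.exp (toyEB q q C₅
            (fun i => (Real.sqrt ((gIR ^ 2)⁻¹ + b * ((K + 1 - (i + 1) : ℕ) : ℝ)))⁻¹) (q ^ (K + 1)) X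
          - toyEB q q C₅ (fun i => (Real.sqrt ((gIR ^ 2)⁻¹ + b * ((K + 1 - (i + 1) : ℕ) : ℝ)))⁻¹) 0 X))
          - Real.log (Real.exp (toyEA q q (fun k => (Real.sqrt ((gIR ^ 2)⁻¹ + b * ((K - k : ℕ) : ℝ)))⁻¹) (q ^ K) X
          - toyEA q q (fun k => (Real.sqrt ((gIR ^ 2)⁻¹ + b * ((K - k : ℕ) : ℝ)))⁻¹) 0 X)))|
      ≤ (1 - q) * q ^ (K + j)
    rw [Finset.filter_eq', if_pos (mem_range.mpr (Nat.lt_succ_of_le hj)), sum_singleton, Real.log_exp,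
      Real.log_exp]
    simp only [toyEA, toyEB]
    have e : q ^ j * q ^ (K + 1) + ∑ i ∈ range j, q ^ (j - i) *
          (Real.sqrt ((gIR ^ 2)⁻¹ + b * ((K + 1 - (i + 1) : ℕ) : ℝ)))⁻¹ - C₅ * q ^ j
        - (q ^ j * 0 + ∑ i ∈ range j, q ^ (j - i) *
          (Real.sqrt ((gIR ^ 2)⁻¹ + b * ((K + 1 - (i + 1) : ℕ) : ℝ)))⁻¹ - C₅ * q ^ j)
        - (q ^ j * q ^ K + ∑ i ∈ range j, q ^ (j - i) * (Real.sqrt ((gIR ^ 2)⁻¹ + b * ((K - i : ℕ) : ℝ)))⁻¹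
          - (q ^ j * 0 + ∑ i ∈ range j, q ^ (j - i) * (Real.sqrt ((gIR ^ 2)⁻¹ + b * ((K - i : ℕ) : ℝ)))⁻¹))
        = -((1 - q) * q ^ (K + j)) := by ring
    rw [e, abs_neg, abs_of_nonneg (mul_nonneg (by linarith) (pow_nonneg hq0.le _))]
  · -- `hSle`: `(1 − q)q^{K+j} ≤ 1·(1·(K+1)^0·q^{K−j})`
    show (1 - q) * q ^ (K + j) ≤ 1 * (1 * ((K : ℝ) + 1) ^ 0 * q ^ (K - j))
    rw [pow_zero, one_mul, one_mul, one_mul]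
    exact (mul_le_of_le_one_left (pow_nonneg hq0.le _) (by linarith)).trans
      (pow_le_pow_of_le_one hq0.le hq1.le (by omega))

end Sanity

end Summit.QuantumFields.YangMills.BalabanUVNodes.N19ConstantsWindow
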